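import Mathlib
import HarnessLib
import HarnessLib.Audit
import Summits.HodgeConjecture.Statement
import Literature.AlgebraicGeometry.Motives.PeriodComparison
import Literature.AlgebraicGeometry.Motives.CrystallineFrobenius
import Literature.AlgebraicGeometry.Motives.Sweep1
import Literature.AlgebraicGeometry.HodgeTheory.HodgeConjecture
import Summits.HodgeConjecture.HodgeConjecture.Theorems.HolomorphicDefectHodgeModelsExist
import HarnessLib.Audit.Status.Attr

/-!
Route: AdelicCoherence

DORMANT since 2026-08-24T05:41:54Z (reconciler: no traction for 6.6 d (last activity item-proof-filed at 2026-08-17T15:19:29Z); parked, not closed — `ledger route dormant route-HodgeConjecture-AdelicCoherence --off` to reactivate) — unstaffed, not closed; items shared with open routes are served there. `ledger route dormant <id> --off` reactivates.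

# Route AdelicCoherence — Three planes must be one — Hodge plane = de Rham k-plane = Frobenius-Tate
plane for varieties over number fields (Ogus coherence), carried to HC by Qbar-descent

Card adelic-coherence-attractor-planes ("three planes must be one"), generalised from rank-2
attractor planes to every Hodge plane and made DECIDING. For X smooth projective over a NUMBER FIELD
k with an embedding ρ : k → ℂ, a schema-pinned period realization P over k (tree PeriodComparison;
the pins are the light hypothesis schemas Hodge–Riemann I, Hodge–Riemann II and hard Lefschetz on
its Betti–Hodge datum P.B, tree Sweep1/WeilCohomology — the stand-in for
PeriodRealization.IsClassical accepted on route PeriodsPolice; the module PeriodRealizationClassical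
is deliberately NOT imported since the 2026-08-15 cone repair, see DEFINITION REQUESTS) and the
crystalline Frobenius data Φ_v at the places of good reduction (tree CrystallineFrobenius), it
suffices to show X = D ∧ F ∧ C: (D = DeRhamPlanes) the plane of Hodge classes Hdgᵖ(X_ρ) ⊗ ℂ is the
complexification of a k-rational plane W of algebraic de Rham cohomology H²ᵖ_dR(X/k) [card (P_dR) =
(P_∞); Ogus1982 Hope 4.11.1, de Rham part]; (F = FrobeniusPlanes) every k-rational de Rham class
landing in the Hodge plane is POTENTIALLY TATE at every good place v: φ_v^m w = q_v^{pm} w for some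
m ≥ 1 [card (P_p); Ogus1982 Hopes 4.11.1+4.11.2]; (C = CoherentClassesAlgebraic) Hodge classes lying
in such a coherent (de Rham-rational, potentially-Tate) plane are classes of algebraic cycles on X_ρ
['absolutely Hodge-and-Tate ⇒ algebraic']. D → F → C give the Hodge conjecture for every X₁ ×_ρ ℂ,
X₁ over a number field (target HodgeConjectureNumberFields), through the real-carrier bridge now
carried by the construction item ClassicalPeriodData (for the classical datum it is the tree theorem
PeriodRealization.IsClassical.hodgeConjectureFor) and the shared item HodgeModelsExist; the shared
items NumberFieldReduction (EGA descent ℚ̄ → number field) and QbarDescent (Voisin-strength: HC over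
ℚ̄ ⇒ HC, verbatim PeriodsPolice.QbarDescent) carry it to the summit. The card's rank-2 attractor
planes (CandelasEtAl2020 AESZ34 at −1/7, BonischEtAl2024 §3.3) are the support special case
AttractorPlanesCoherent and the route's decidable test-bed.
Lean: `DeRhamPlanes ∧ FrobeniusPlanes ∧ CoherentClassesAlgebraic`

## Assembly
Genuine composition, sorry-free (Sketch.lean `closes`, lean check rc 0, axioms
propext/Classical.choice/Quot.sound): QbarDescent reduces the summit to ℚ̄-definable varieties,
NumberFieldReduction to X₁ ×_ρ ℂ with X₁ over a number field k; ClassicalPeriodData gives a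
schema-pinned P over k together with its real-carrier bridge, which (fed the Hodge model from
HodgeModelsExist) reduces HodgeTheory.HodgeConjectureFor to P.B.HodgeConjectureFor hXρ p for all p,
i.e. (BettiHodgeData.hodgeConjectureFor_iff) Hdgᵖ ≤ ℚ·Aᵖ; given a Hodge class β, DeRhamPlanes yields
the k-plane W, FrobeniusPlanes makes every w ∈ W potentially Tate at every good place for every Φ,
and CoherentClassesAlgebraic returns β ∈ ℚ·Aᵖ(X_ρ).

Rationale: WHY THIS LINE. Ogus1982 §4 (LNM 900 pp. 299–313, READ) splits Deligne's absoluteness programme into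
three 'Hopes' — 4.11.1 Hodge ⇒ absolutely Hodge, 4.11.2 absolutely Hodge ⇒ absolutely Tate
(crystalline Frobenius fixes the de Rham class at almost every place), 4.11.3 absolutely Tate ⇒
absolutely Hodge — proves 4.11.1–2 for abelian varieties, K3, Fermat (Thm 4.14; Blasius1994 adds the
p-adic comparison) and shows H_AT ⊗_ℚ k ↪ H_dR (Prop 4.9): over a number field a Hodge class should
have THREE rational incarnations (Betti plane, de Rham k-plane, Frobenius-Tate plane) that coincide.
Imported: arithmetic geometry (crystalline cohomology, Berthelot–Ogus comparison, Katz–Messing;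
Bost's algebraic-foliation theorem doi:10.1007/s10240-001-8191-3 and Tang
doi:10.1112/s0010437x17007679 as the only engines for the converse) and certified numerics of
Calabi–Yau periods / Dwork–Frobenius matrices (CandelasEtAl2020, BonischEtAl2024, arXiv:2104.07816)
as the refutation instrument. What no open route does: QbarEnvelope foresees only the ℓ-adic split
of its C1, LosTransfer stakes ℓ-adic potential-Tateness,
PadicSemiregularLift/SupersingularIsotypicLift LIFT from one prime; nobody stakes the de
Rham/crystalline COHERENCE of Hodge classes across all primes, which is exactly what is exactly
computable at a rational attractor (BKSZ integer matrices give the rational de Rham plane; U_p(s₀)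
is computable mod p^N for every p) — crux 2 is decidable prime by prime there. The negatives index
is empty; gen-0 (AttractorPlanes) was retired only for not reaching the Statement, which this
route's `closes` does.

RANKED CRUXES. #0 HodgeConjectureNumberFields (target) — the Hodge conjecture (real carriers,
HodgeTheory.HodgeConjectureFor) for every X₁ ×_ρ ℂ with X₁ smooth projective over a number field k
and ρ : k →+* ℂ — what D ∧ F ∧ C decide directly (Sketch.lean `target_of_cruxes`); QbarDescent ∘
NumberFieldReduction carries it to the summit. (why it might fail: it is HC for
number-field-definable varieties: Weil classes on CM abelian varieties of dimension ≥ 5/6 and level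
≥ 3 hypersurfaces over ℚ̄ are open exactly as HC is.) [Deligne2000, Deligne1982HodgeCycles,
Ogus1982, CharlesSchnell2014Notes]
#2 FrobeniusPlanes (crux) — (card (P_p); Ogus Hopes 4.11.1+4.11.2 in plane form) k number field, ρ :
k →+* ℂ, P a schema-pinned period realization over k (Hodge–Riemann I/II + hard Lefschetz for P.B:
the light stand-in for PeriodRealization.IsClassical since the 2026-08-15 cone repair), X/k smooth
projective of dim n, p, v a place of good reduction, Φ a crystalline Frobenius datum at v
(coefficients k_v): every k-rational de Rham class w ∈ H²ᵖ_dR(X/k) whose ρ-complexification lies in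
the Hodge plane Hdgᵖ(X_ρ) ⊗ ℂ is potentially Tate at v — φ_v^m (1 ⊗ w) = q_v^{pm} (1 ⊗ w) for some m
≥ 1 ('potentially': φ_v = q^p itself is false, e.g. w = i·(cl Γ_i − cl Γ_{−i}) on E×E, E: y² = x³ −
x, at inert p; m = [k′:k] suffices under HC). Known for abelian varieties, K3, Fermat (Ogus1982 Thm
4.14, Blasius1994). At a rational rank-2 attractor it says: the BKSZ rational de Rham plane is
U_p(s₀)-stable for every good p. [difficulty: open-problem] (why it might fail: = Ogus Hopes
4.11.1+4.11.2 beyond abelian/K3/Fermat (Ogus1982 4.14): one rational CY3 attractor whose exact BKSZ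
de Rham plane is not U_p^m-stable at one good p refutes it and HC(X×X); as typed (∀ schema-pinned P,
∀ Φ) exotic period / Frobenius data could also refute it.) [Ogus1982, Blasius1994,
doi:10.1112/s0010437x17007679, BerthelotOgus1983, KatzMessing1974, CandelasEtAl2020,
BonischEtAl2024, arXiv:2104.07816, CharlesSchnell2014Notes]
#3 CoherentClassesAlgebraic (crux) — ('absolutely Hodge-and-Tate ⇒ algebraic', the weakest converse
that suffices) same setting; for every k-plane W ≤ H²ᵖ_dR(X/k) whose ρ-complexification lies in the
Hodge plane and all of whose elements are potentially Tate at every good place for every Frobenius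
datum, every Hodge class β of X_ρ with β ⊗ 1 in the ℂ-span of ι(W) lies in the ℚ-span of Betti
classes of algebraic cycles on X_ρ (P.B.W.algebraicClasses). Implied by HC outright; engines:
Ogus1982 4.16 (CM abelian, Fermat: AT ⇒ AH), André motivated cycles + B(X), Bost/Tang (degree 2 on
abelian varieties). [deps: FrobeniusPlanes, DeRhamPlanes] [difficulty: open-problem] (why it might
fail: 'absolutely Hodge-Tate ⇒ algebraic' has no engine off CM-abelian/Fermat (Ogus1982 4.16;
Tang/Bost only degree 2 on abelian varieties); it contains Künneth C over number fields (Ogus1982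
p.308: Künneth components are absolutely Tate) and HC for Weil classes.) [Ogus1982,
Deligne1982HodgeCycles, doi:10.1112/s0010437x17007679, doi:10.1007/s10240-001-8191-3,
Andre1996Motifs, Andre2004, CharlesSchnell2014Notes]
#4 DeRhamPlanes (crux) — (card (P_dR) = (P_∞); de Rham part of Ogus Hope 4.11.1 / CharlesSchnell
Conj 11.2.17 for number-field varieties, in plane form) same setting; there is a k-subspace W ≤
H²ᵖ_dR(X/k) such that ι(W) ⊆ Hdgᵖ(X_ρ) ⊗ ℂ and every Hodge class β has β ⊗ 1 in the ℂ-span of ι(W),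
ι = P.iso ρ read in ℂ ⊗_ℚ H_B (so the ℂ-span of ι(W) IS the Hodge plane). Under HC, W = Galois
descent of the k̄-span of cycle classes. At a rational rank-2 attractor of a CY3 pencil: the ratios
of the 2×2 minors of the 2×3 attractor period matrix (∫_{δ_i}∇^jΩ(s₀)) lie in k (numerically
verified in print for AESZ34 and the BKSZ hypergeometric attractors). [difficulty: open-problem]
(why it might fail: = de Rham part of 'Hodge ⇒ absolute Hodge' off abelian type (Ogus Hope 4.11.1;
Voisin2007/KOU2023/Urbanik2022 need positive-dimensional Hodge loci): one irrational period-minor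
ratio at a rational attractor refutes it and HC; ∀-P typing admits exotic de Rham data.) [Ogus1982,
Deligne1982HodgeCycles, CharlesSchnell2014Notes, Voisin2007HodgeLoci, KlinglerOtwinowskaUrbanik2023,
doi:10.1112/s0010437x2200745x, CandelasEtAl2020, BonischEtAl2024]
#5 QbarDescent (crux) — (shared verbatim with PeriodsPolice.QbarDescent; Voisin-strength ℚ̄-descent)
if the Hodge conjecture holds for every smooth projective complex variety of the form X₀ ×_{ℚ̄,σ} ℂ,
then it holds for all smooth projective complex varieties. Voisin2007HodgeLoci Prop 1.2 proves it
for weakly absolute Hodge classes (global invariant cycle theorem over a ℚ̄-compactification of the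
Hodge-locus component); in general it is the field-of-definition half of absoluteness. [difficulty:
open-problem] (why it might fail: proved only for weakly absolute classes (Voisin2007 Prop 1.2):
false iff HC holds over ℚ̄ but a rigid Hodge class at a transcendental isolated Hodge-locus point
has no ℚ̄-envelope (the zero-period-dimension case KOU2023/BKU2024 leave open).)
[Voisin2007HodgeLoci, CharlesSchnell2014Notes, KlinglerOtwinowskaUrbanik2023,
BaldiKlinglerUllmo2024]
#9 NumberFieldReduction (support) — KNOWN (EGA IV₃ 8.8.2/8.10.5/17.7.8 + isomorphism invariance of
HodgeConjectureFor): HC for all X₁ ×_ρ ℂ with X₁ smooth projective over a number field implies HC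
for all X₀ ×_σ ℂ with X₀ over ℚ̄ — a finitely presented smooth projective geometrically irreducible
ℚ̄-scheme descends to a number field k ⊂ ℚ̄ with the same properties, X₀ ×_σ ℂ ≅ X₁ ×_{σ|k} ℂ, and
HodgeConjectureFor is transported along isomorphisms of ℂ-schemes (homeomorphism of complex points,
Hodge types and supports of classes). [difficulty: L] [EGAIV3, VoisinHodgeI2002, Deligne2000]
#9 ClassicalPeriodData (support) — CONSTRUCTION + BRIDGE statement for the interface (existence is
never a field of the hypothesis structures; restated in the 2026-08-15 cone repair): for every
number field k there is a period realization P over k which (i) is schema-pinned —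
HodgeRiemannIStatement P.B, HodgeRiemannIIStatement P.B (VoisinHodgeI2002 Thm 6.32),
P.B.W.HasHardLefschetz; (ii) carries the real-carrier bridge: for every smooth projective complex Y
of dimension n with a Hodge model, the P.B-relative Hodge conjecture (∀ p, P.B.HodgeConjectureFor)
implies HodgeTheory.HodgeConjectureFor n Y — for the classical datum this is the tree THEOREM
BettiHodgeData.IsClassical.hodgeConjectureFor (Motives/PeriodRealizationClassical, not imported
here); (iii) carries a crystalline Frobenius datum with coefficients k_v at every finite place
(Grothendieck 1966 comparison + Berthelot–Ogus 1983 Thm 2.4/4.2 + Katz–Messing 1974; cf. the tree's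
named facts exists_crystallineFrobeniusDatum, IsSmoothProjective.baseChangeHom). `closes` uses (i)
and (ii); (iii) records that the Tate hypothesis of CoherentClassesAlgebraic is not vacuous. Proof
route: the classical P (∃ P, P.IsClassical) + Hodge–Riemann/hard Lefschetz for the Kähler manifold
X^an transported along IsClassical (i) + the tree bridge. [difficulty: XL] [Grothendieck1966,
BerthelotOgus1983, KatzMessing1974, VoisinHodgeI2002, Deligne2000]
#9 HodgeModelsExist (support) — (shared verbatim with
PeriodDeficiency/FiniteTreeOfFlavours.HodgeModelsExist = ∀ n X, nonempty_hodgeModel n X) every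
smooth projective complex variety has a Hodge model (Serre GAGA §2 + de Rham + Hodge decomposition);
the first conjunct of HodgeConjectureFor and the Hodge model consumed by the bridge of
ClassicalPeriodData. THE route's one genuine named-fact debt (needs-fact:
Literature.AlgebraicGeometry.HodgeTheory.nonempty_hodgeModel; open leaves per
HodgeModelExistenceDischarge: isInternal_hodgePQ, exists_(complex)DeRhamIsoFamily). [difficulty: L]
[SerreGAGA1956, VoisinHodgeI2002, Deligne2000]
#9 AttractorPlanesCoherent (support) — THE CARD'S NAME-SAKE SPECIAL CASE (rank-2 attractor planes;
test-bed of cruxes 2 and 4): k number field, ρ, P schema-pinned, X/k smooth projective of dim n, T ≤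
Hⁿ_B(X_ρ, ℚ) a rational plane of rank 2 containing Fⁿ = H^{n,0} with h^{n,0} = 1 (T_ℂ = H^{n,0} ⊕
H^{0,n}, the unique such sub-Hodge structure: CY3 pencils at rational rank-2 attractors,
CandelasEtAl2020 AESZ34 at s₀ = −1/7, BonischEtAl2024 §3.3; singular K3 for n = 2). CLAIM: T_ℂ =
iso_ρ(W ⊗ ℂ) for a k-plane W ≤ Hⁿ_dR(X/k) (spelled like the axiom iso_fil), AND at every good place
v, for every Frobenius datum Φ, W ⊗ k_v is φ_v^m-stable for some m ≥ 1. HC(X_ρ × X_ρ) implies it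
with m = 1 (π_T is the class of a k-rational ℚ-cycle by uniqueness of T + Galois averaging;
Gillet–Messing). Decidable instance: PSLQ on period minors (done in print) + U_p(s₀)-stability of
the BKSZ rational plane mod p^N for p = 5…31. [difficulty: open-problem] [CandelasEtAl2020,
BonischEtAl2024, arXiv:2104.07816, Ogus1982, CharlesSchnell2014Notes]

TWO-LAYER PLAN. Foreseen glued splits (k ≤ 3, depth 1), none filed now: FrobeniusPlanes ⇐
HodgePlaneAbsolute (classes of W are Hodge at EVERY embedding σ : k → ℂ — Ogus Hope 4.11.1 for the
plane) → AbsoluteImpliesTate (absolutely Hodge k-rational classes are potentially Tate at every good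
place — Hope 4.11.2; theorem for abelian/K3/Fermat, Ogus 4.14) → FrobeniusPlanes.
CoherentClassesAlgebraic ⇐ CoherentImpliesMotivated (coherent Hodge classes are André-motivated) →
LefschetzBNumberFields (standard conjecture B for X_ρ, shared decl with PeriodsPolice.LefschetzB;
motivated ⇒ algebraic is the tree theorem WeilCohomology.motivatedClasses_le_algebraicClasses) →
CoherentClassesAlgebraic. DeRhamPlanes ⇐ ConjugationPermutesHodgePlanes (Aut(ℂ/k) permutes the Hodge
planes of the conjugates X_σ) → GaloisDescentOfPlanes (linear algebra) → DeRhamPlanes.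

KILL CRITERIA. (a) A CERTIFIED instance of ¬AttractorPlanesCoherent / ¬FrobeniusPlanes for the
Berthelot–Ogus Frobenius — the exact rational BKSZ de Rham plane of a rational rank-2 attractor not
U_p(s₀)^m-stable (m ≤ 12) at one good prime, from the Dwork–Frobenius matrix mod p^N — refutes the
item: close `refuted:FrobeniusPlanes`; mathematically it refutes HC for the sixfold X×X, so the
witness is filed as evidence against every Hodge route. If instead a refuter kills an item with an
EXOTIC period realization / Betti–Hodge re-decoration / Frobenius datum (hypothesis-structure
artefact, no geometry), that is `misstated`: restate under the strong classicality predicate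
(light-cone IsClassical core + clause (iii) + Frobenius classicality, DEFINITION REQUESTS) when it
lands, not a kill. (b) A PROVEN irrational ratio of attractor period minors refutes DeRhamPlanes and
HC alike (numerics alone cannot: weak approximation). (c) CoherentClassesAlgebraic can only die with
HC. (d) ¬QbarDescent kills every ℚ̄-anchored route (shared item). (e) The route dies AS A STRATEGY
(close superseded → QbarEnvelope) if D ∧ F turn out provably equivalent to full absoluteness with no
crystalline leverage on C, i.e. if no Bost/Tang-type engine exists beyond degree 2; it is mooted if
QbarEnvelope.HCOverNumberFields is proved by other means.

NOT DECOMPOSED YET. The abelian-type case of F and D (theorems: Ogus 4.14, Blasius1994, Deligne —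
support items once a prover wants them); the split of C through motivated cycles and B(X); the
ℓ-adic fourth plane (LosTransfer.HodgeClassesPotentiallyTate, Blasius's p-adic comparison) —
deliberately not an item here; 'potentially' via an honest base-change structure k → k′ for
PeriodRealization/CrystallineFrobeniusDatum (would also let HC ⇒ F be proved inside the tree);
flux-vacuum planes of type (2,1)+(1,2) (KachruNallyYang2024; uniqueness fails, only ℚ̄-rationality
predicted) and CY4 (2,2) classes; the certified-numerics protocol itself (kit: Arb periods + PSLQ;
Dwork matrices mod p^N), which lands as EVIDENCE on AttractorPlanesCoherent, never as an item.

CHEAPEST FALSIFIER. One kit-sized job, not run in this plancard session (no Dwork-deformation code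
at hand): take the two hypergeometric rank-2 attractors of BonischEtAl2024 §3.3 (z = −2⁻⁴3⁻³ and z =
−2⁻³3⁻⁶, where the INTEGER matrices giving the rational de Rham plane T_dR in the basis ∇^jΩ are
printed) and AESZ34 at s₀ = −1/7 (CandelasEtAl2020); compute the Dwork–Frobenius matrix U_p(z₀) of
the Picard–Fuchs operator mod p^20 for the good primes 5 ≤ p ≤ 31 (method of arXiv:2104.07816) and
test whether T_dR ⊗ ℚ_p is U_p-stable (HC predicts m = 1 since π_T is the class of a ℚ-rational
cycle). Stable at all p: strongest evidence yet that attractor splittings are motivic (record on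
AttractorPlanesCoherent). Unstable at one p for all m ≤ 12: kill criterion (a). Known theorem that
kills a crux as typed: none found (Ogus 4.14/4.16 are positive; negatives index empty).

NUMBERS. Ogus1982 Thm 4.14: Hopes 4.11.1–2 hold for abelian varieties, K3 surfaces, Fermat
hypersurfaces, projective spaces; Thm 4.16: Hope 4.11.3 for CM abelian varieties, Fermat
hypersurfaces; Prop 4.9: H_AT ⊗_ℚ k ↪ H_dR. Tang (doi:10.1112/s0010437x17007679) Thm 1/3: de
Rham–Tate = Hodge for abelian varieties over ℚ with connected G_ℓ under Mumford–Tate, and for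
products of elliptic/CM/prime-dimensional factors. Test points: AESZ34 attractors −1/7, 33 ± 8√17
(CandelasEtAl2020); BKSZ hypergeometric attractors z = −2⁻⁴3⁻³ (E = 32a, CM by ℤ[i]), z = −2⁻³3⁻⁶
(BonischEtAl2024 §3.3). Items: 10 (target, 4 cruxes, 4 support, assembly). CONE (repair 2026-08-15,
unit rrepair-HodgeConjecture-AdelicCoherenc-787200ee): at rev 0 the gate's decl cone was clean (222
project constants, 0 unproved, staffable) but the MODULE cone carried 15 unproved closed named
facts, all riding in on the single import Motives.PeriodRealizationClassical through its own imports
(HodgeTheory.RealStructureSingular → ComplexConjugation → {HodgeModelExistence,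
Motives.HodgeDecomposition → Transcendental.KaehlerHodge}; Motives.BettiCycleClass →
AlgebraicEquivalence → SubschemeCycles). Imports are now PeriodComparison, CrystallineFrobenius,
Sweep1 (adds only Sweep1 + Lefschetz, whose four closed facts all have _holds),
HodgeTheory.HodgeConjecture: 1 import dropped (−83 modules), 3 cruxes + 2 supports restated, closes
re-proved. needs-fact: Literature.AlgebraicGeometry.HodgeTheory.nonempty_hodgeModel ONLY (= shared
item HodgeModelsExist, kept). not-needed by any item or by closes: flatPullback_mem_ratTrivial,
flatPullback_algTrivial_le, sum_hodgeNumber_eq_finrank_complexDeRham,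
cmcoderiv_eq_dolbeaultAdjoint_add_dolbeaultBarAdjoint, dolbeaultHarmonicForms_conj,
isDolbeaultHarmonic_iff, finite_dolbeaultHarmonicForms, hodgeNumber_symm_of_isKaehlerManifold,
existsUnique_isDolbeaultHarmonic_of_mem_hodgePQ, exists_hodgePQ_equiv_dolbeaultCohomology,
hasHardLefschetzProperty_kaehlerClass, hodge_riemann_bilinear, isInternal_hodgePQ,
exists_isReal_hodgeModel — the Kähler package enters only the eventual PROOF of the XL construction
item ClassicalPeriodData (and isInternal_hodgePQ that of HodgeModelsExist), never a crux.

DEFINITION REQUESTS. Landed: CrystallineFrobeniusDatum (gen-0 request) and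
PeriodRealization.IsClassical v1 — but the latter's module (Motives/PeriodRealizationClassical)
imports HodgeTheory.RealStructureSingular (for coeffClass/ofRatClass only) and
Motives.BettiCycleClass (for clause (ii-b) only), dragging 15 unproved named facts into every
consumer's module cone; this route therefore states its items over the light schema pins (HR-I/II +
hard Lefschetz) instead. WANTED (filed with this repair, for tenure): a LIGHT-CONE strong
classicality predicate — `PeriodRealization.IsClassical` clauses (i)/(i')/(ii-a) re-homed to a
module importing only PeriodComparison + HodgeTheory.HodgeConjecture/HodgeFiltration + a binder-free
coefficient-change file (coeffClass/ofRatClass are pure singular-cochain algebra, Hatcher §3.1),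
PLUS clause (iii) pinning P.dR/P.iso to Grothendieck's algebraic de Rham cohomology and comparison,
PLUS a classicality clause for CrystallineFrobeniusDatum (= the Berthelot–Ogus Frobenius) — then
restate items 2, 3, 4, AttractorPlanesCoherent and ClassicalPeriodData under it (1:1, sharper, same
cone); (ii) a base-change structure PeriodRealization k → PeriodRealization k′ along finite
extensions (to say 'potentially Tate' literally and to prove HC ⇒ FrobeniusPlanes in the tree). Bib:
Tang 2018 and Bost 2001 are cited by DOI (no bib keys yet).

Novelty: Searches (2026-08-15): `lit search` local/hybrid ×3 (searchd rc 75 all session — logged); `lit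
galaxy search --star all` "absolutely Tate" (2 rows: LNM 900 itself + noise), "de Rham-Tate cycles"
(0), "Ogus conjecture" (0), long phrase (0); crossref: 'Tang cycles de Rham cohomology abelian
varieties number fields' (→ doi:10.1112/s0010437x17007679), 'Bost algebraic leaves' (→
doi:10.1007/s10240-001-8191-3), 'Blasius p-adic property' (→ doi:10.1090/pspum/055.2/1265557),
'rational conjugates Urbanik' (→ doi:10.1112/s0010437x2200745x, doi:10.24033/asens.2555,
doi:10.2140/ant.2026.20.971 Howe–Klevdal 2026 'transcendence of the de Rham lattice',
doi:10.1007/s00208-024-02936-3), 'Candelas de la Ossa van Straten zeta' (→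
doi:10.1007/jhep10(2020)202, doi:10.21468/scipostphys.20.2.028); READ: LNM 900 pp. 299–313 (Ogus §4:
4.1, 4.4, 4.8–4.16) via lit read book:deligne1982-hodge-cycles-motives-shimura-varieties;
arXiv:1510.01357 pp. 1–3 (Tang); tree: headers of 12 open Hodge routes (QbarEnvelope, PeriodsPolice,
PeriodDeficiency, FiniteTreeOfFlavours, LosTransfer, PadicSemiregularLift,
SupersingularIsotypicLift, AnchorTransport, LimitExtension, SecondaryPeriods, DeltaPeriodAudit,
AmpleAdicLefschetz), Literature CrystallineFrobenius / PeriodRealizationClassical /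
HodgeClassesPotentiallyTate / HodgeConjectureQbarVoisin; the card's 7 refuter audits (BKSZ §3.3,
CdOEvS, CdOvS, Golyshev–van Straten acq-01863 unread).
Nearest prior art found: Ogus1982 §4 Hopes 4.11.1–3 with Thm 4.14/4.16 (the coh  [refs: 10.1112/s0010437x17007679, 10.1007/s10240-001-8191-3, 10.1090/pspum/055.2/1265557, 10.1112/s0010437x2200745x, 10.24033/asens.2555, 10.2140/ant.2026.20.971, 10.1007/s00208-024-02936-3, 10.1007/jhep10(2020, 10.21468/scipostphys.20.2.028, 1510.01357, doi:10.1112/s0010437x17007679, doi:10.1007/s10240-001-8191-3, doi:10.1090/pspum/055.2/1265557, doi:10.1112/s0010437x2200745x, doi:10.24033/asens.2555, d]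

Barriers (technique_class: absolute-hodge, crystalline-comparison, arithmetic-descent): - technique_class: absolute-hodge, crystalline-comparison, arithmetic-descent
- Literature.Barriers.HodgeConjecture.hodgeClassesAreAbsoluteFor_abelianVariety: on abelian
varieties DeRhamPlanes and FrobeniusPlanes are THEOREMS (Deligne; Ogus1982 Thm 4.14; Blasius1994),
so no refutation of D/F can come from abelian type and C restricted to abelian varieties is exactly
HC(AV); the barrier bounds WHERE the route is informative (CY3 pencils with Sp(4) monodromy, level ≥
3 — the attractor census), it does not block it.
- Literature.Barriers.HodgeConjecture.CattaniDeligneKaplan1995_hodgeLocus_algebraicFor: not used and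
not in the way — no Hodge locus appears; the tested content is the field of definition / de Rham
rationality of the CLASS at a rational point (the evasion the catalogue lists).
- Literature.Barriers.HodgeConjecture.Serre1964_conjugateVarieties_notHomeomorphic: evaded — no
Betti class is transported along Aut(ℂ); X is fixed over k with ONE embedding ρ, and only the
k-structure of algebraic de Rham cohomology and Frobenius at finite places are compared with the
Hodge plane.
- Literature.Barriers.HodgeConjecture.Charles2009_conjugateVarieties_cohomologyAlgebrasNotIso:
consistent — D asks de Rham rationality of the Hodge PLANE only, not a ℚ-isomorphism of cohomology
algebras of conjugates; Charles's conjugate pairs have corresponding algebraic (hence Hodge)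
classes.
- Literature.Barriers.HodgeConjecture.Andre1996_hodgeClassesOnAbelianVarieties_motivated:
refutation-side a

History (route lifecycle, newest last):
- 2026-08-15T19:37:09Z · rev 2: restated FrobeniusPlanes (stmt-HodgeConjecture-13517), CoherentClassesAlgebraic (stmt-HodgeConjecture-13518), DeRhamPlanes (stmt-HodgeConjecture-13519), ClassicalPeriodData (stmt-HodgeConjecture-13521), AttractorPlanesCoherent (stmt-HodgeConjecture-13522) — cone-repair (unit rrepair-HodgeConjecture-AdelicCoheren (planner-rrepair-HodgeConjecture-AdelicCoherenc-787200ee-0)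
- 2026-08-16T03:25:44Z · rev 4: restated CoherenceGlue (stmt-HodgeConjecture-14206) — badge repair (rbadge 787200ee): restate CoherenceGlue (stmt-HodgeConjecture-14206, rendered BLOCKED: forward reference to the shared item HodgeModelsExist which (planner-rbadge-HodgeConjecture-AdelicCoherence-787200ee-0)
- 2026-08-24T05:41:54Z · DORMANT — reconciler: no traction for 6.6 d (last activity item-proof-filed at 2026-08-17T15:19:29Z); parked, not closed — `ledger route dormant route-HodgeConjecture-Ade (operator:999:3421049)

sub-problem: HodgeConjecture · status: dormant · opened planner-plancard-HodgeConjecture-HodgeConject-06f74e71-g2-0 2026-08-15T19:02:04Z · rev 4 · ledger route-HodgeConjecture-AdelicCoherence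
GENERATED by the gate from the ledger (D-0016/17). Provers cite these decls: `theorem foo : Summit.HodgeConjecture.HodgeConjecture.Theses.AdelicCoherence.<Decl> := …` in Summits/HodgeConjecture/HodgeConjecture/Theorems/<Name>.lean.
-/

namespace Summit.HodgeConjecture.HodgeConjecture.Theses.AdelicCoherence

open scoped BigOperators Topology Manifold Classical MeasureTheory ProbabilityTheory Matrix InnerProductSpace ComplexConjugate ContinuousMap
open Filter Set Function TopologicalSpace MeasureTheory

attribute [summit_statement] _root_.HodgeConjecture

/-- item stmt-HodgeConjecture-13516 · target · rank 0 · open · by planner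
why it might fail: It IS the Hodge conjecture for number-field-definable varieties: open exactly as HC off the known cases — e.g. Hodge–Weil classes on Weil-type abelian varieties of dim ≥ 6 over Q̄ (dim 4 only via Markman2025SecantWeil), general CY3/hypersurfaces over Q; definability over k gives no leverage.
sources: Deligne2000, Deligne1982HodgeCycles, Ogus1982, CharlesSchnell2014Notes, Markman2025SecantWeil
[target] the Hodge conjecture (real carriers, HodgeTheory.HodgeConjectureFor) for every X₁ ×_ρ ℂ
with X₁ smooth projective over a number field k and ρ : k →+* ℂ — what D ∧ F ∧ C decide directly
(Sketch.lean `target_of_cruxes`); QbarDescent ∘ NumberFieldReduction carries it to the summit. -/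
@[route_item "route-HodgeConjecture-AdelicCoherence"]
def HodgeConjectureNumberFields : Prop :=
  ∀ ⦃k : Type⦄ [Field k] [NumberField k] (ρ : k →+* ℂ) ⦃n : ℕ⦄ ⦃X : Literature.AlgebraicGeometry.Motives.SchemeOver k⦄, Literature.AlgebraicGeometry.Motives.IsSmoothProjective n X → Literature.AlgebraicGeometry.Motives.IsSmoothProjective n ((Literature.AlgebraicGeometry.Motives.baseChangeHom ρ).obj X) → Literature.AlgebraicGeometry.HodgeTheory.HodgeConjectureFor n ((Literature.AlgebraicGeometry.Motives.baseChangeHom ρ).obj X)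

-- earlier FrobeniusPlanes (stmt-HodgeConjecture-13517, replaced 2026-08-15T19:37:09Z -> stmt-HodgeConjecture-13695): retired by None — ∀ ⦃k : Type⦄ [Field k] [NumberField k] (ρ : k →+* ℂ) (P : Literature.AlgebraicGeometry.Motives.PeriodRealization k), P.IsClassical → ∀ ⦃n : ℕ⦄ ⦃X : Literature.AlgebraicGeometry.Motives.SchemeOver k⦄, Literature.AlgebraicGeometry.Motives.IsSmoothProjective n X → ∀ (hX
/-- item stmt-HodgeConjecture-13695 · crux · rank 2 · open · by planner
why it might fail: = Ogus Hopes 4.11.1+4.11.2 beyond abelian/K3/Fermat (Ogus1982 4.14): one rational CY3 attractor whose exact BKSZ de Rham plane is not U_p^m-stable at one good p refutes it and HC(X×X); as typed (∀ schema-pinned P, ∀ Φ) exotic period/Frobenius data could also refute it.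
sources: Ogus1982, Blasius1994, doi:10.1112/s0010437x17007679, BerthelotOgus1983, KatzMessing1974, CandelasEtAl2020
[crux] (card (P_p); Ogus Hopes 4.11.1+4.11.2 in plane form) k number field, ρ : k →+* ℂ, P a
schema-pinned period realization over k (HodgeRiemannIStatement P.B, HodgeRiemannIIStatement P.B,
P.B.W.HasHardLefschetz — the light stand-in for PeriodRealization.IsClassical since the 2026-08-15
cone repair), X/k smooth projective of dim n, p, v a place of good reduction, Φ a crystalline
Frobenius datum at v (coefficients k_v): every k-rational de Rham class w ∈ H²ᵖ_dR(X/k) whose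
ρ-complexification lies in the Hodge plane Hdgᵖ(X_ρ) ⊗ ℂ is potentially Tate at v — φ_v^m (1 ⊗ w) =
q_v^{pm} (1 ⊗ w) for some m ≥ 1 ('potentially': φ_v = q^p itself is false, e.g. w = i·(cl Γ_i − cl
Γ_{−i}) on E×E, E: y² = x³ − x, at inert p; m = [k′:k] suffices under HC). Known for abelian
varieties, K3, Fermat (Ogus1982 Thm 4.14, Blasius1994). At a rational rank-2 attractor it says: the
BKSZ rational de Rham plane is U_p(s₀)-stable for every good p. [difficulty: open-problem] -/
@[route_item "route-HodgeConjecture-AdelicCoherence", crux]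
def FrobeniusPlanes : Prop :=
  ∀ ⦃k : Type⦄ [Field k] [NumberField k] (ρ : k →+* ℂ) (P : Literature.AlgebraicGeometry.Motives.PeriodRealization k), Literature.AlgebraicGeometry.Motives.HodgeRiemannIStatement P.B → Literature.AlgebraicGeometry.Motives.HodgeRiemannIIStatement P.B → P.B.W.HasHardLefschetz → ∀ ⦃n : ℕ⦄ ⦃X : Literature.AlgebraicGeometry.Motives.SchemeOver k⦄, Literature.AlgebraicGeometry.Motives.IsSmoothProjective n X → ∀ (hXρ : Literature.AlgebraicGeometry.Motives.IsSmoothProjective n ((Literature.AlgebraicGeometry.Motives.baseChangeHom ρ).obj X)) (p : ℕ) (v : IsDedekindDomain.HeightOneSpectrum (NumberField.RingOfIntegers k)), Literature.AlgebraicGeometry.Motives.HasGoodReductionAt X n v → ∀ (Φ : Literature.AlgebraicGeometry.Motives.CrystallineFrobeniusDatum P.dR v (v.adicCompletion k)) (w : P.dR.obj X (2 * p)), Literature.AlgebraicGeometry.Motives.alongHomTensorEquiv ρ ((P.B.comap ρ).obj X (2 * p)) (P.iso ρ X (2 * p) ((1 : Literature.AlgebraicGeometry.Motives.AlongHom ℂ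 ρ) ⊗ₜ[k] w)) ∈ ((P.B.hodge hXρ (2 * p)).hodgeClasses p).baseChange ℂ → ∃ m : ℕ, 0 < m ∧ ((Φ.phi X (2 * p)) ^ m) ((1 : v.adicCompletion k) ⊗ₜ[k] w) = ((v.residueCard : v.adicCompletion k) ^ (p * m)) • ((1 : v.adicCompletion k) ⊗ₜ[k] w)

-- earlier CoherentClassesAlgebraic (stmt-HodgeConjecture-13518, replaced 2026-08-15T19:37:09Z -> stmt-HodgeConjecture-13696): retired by None — ∀ ⦃k : Type⦄ [Field k] [NumberField k] (ρ : k →+* ℂ) (P : Literature.AlgebraicGeometry.Motives.PeriodRealization k), P.IsClassical → ∀ ⦃n : ℕ⦄ ⦃X : Literature.AlgebraicGeometry.Motives.SchemeOver k⦄, Literature.AlgebraicGeometry.Motives.IsSmoothProjective n 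
/-- item stmt-HodgeConjecture-13696 · crux · rank 3 · open · by planner
why it might fail: 'absolutely Hodge-Tate ⇒ algebraic' has no engine off CM-abelian/Fermat (Ogus1982 4.16; Tang/Bost only degree 2 on abelian varieties); it contains Künneth C over number fields (Ogus1982 p.308: Künneth components are absolutely Tate) and HC for Weil classes.
sources: Ogus1982, Deligne1982HodgeCycles, doi:10.1112/s0010437x17007679, doi:10.1007/s10240-001-8191-3, Andre1996Motifs, Andre2004
[crux] ('absolutely Hodge-and-Tate ⇒ algebraic', the weakest converse that suffices) same setting (k
number field, ρ, P a schema-pinned period realization over k (HodgeRiemannIStatement P.B,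
HodgeRiemannIIStatement P.B, P.B.W.HasHardLefschetz — the light stand-in for
PeriodRealization.IsClassical since the 2026-08-15 cone repair), X/k smooth projective of dim n, p);
for every k-plane W ≤ H²ᵖ_dR(X/k) whose ρ-complexification lies in the Hodge plane and all of whose
elements are potentially Tate at every good place for every Frobenius datum, every Hodge class β of
X_ρ with β ⊗ 1 in the ℂ-span of ι(W) lies in the ℚ-span of Betti classes of algebraic cycles on X_ρ
(P.B.W.algebraicClasses). Implied by HC outright; engines: Ogus1982 4.16 (CM abelian, Fermat: AT ⇒
AH), André motivated cycles + B(X), Bost/Tang (degree 2 on abelian varieties). [deps: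
FrobeniusPlanes, DeRhamPlanes] [difficulty: open-problem] -/
@[route_item "route-HodgeConjecture-AdelicCoherence", crux]
def CoherentClassesAlgebraic : Prop :=
  ∀ ⦃k : Type⦄ [Field k] [NumberField k] (ρ : k →+* ℂ) (P : Literature.AlgebraicGeometry.Motives.PeriodRealization k), Literature.AlgebraicGeometry.Motives.HodgeRiemannIStatement P.B → Literature.AlgebraicGeometry.Motives.HodgeRiemannIIStatement P.B → P.B.W.HasHardLefschetz → ∀ ⦃n : ℕ⦄ ⦃X : Literature.AlgebraicGeometry.Motives.SchemeOver k⦄, Literature.AlgebraicGeometry.Motives.IsSmoothProjective n X → ∀ (hXρ : Literature.AlgebraicGeometry.Motives.IsSmoothProjective n ((Literature.AlgebraicGeometry.Motives.baseChangeHom ρ).obj X)) (p : ℕ) (W : Submodule k (P.dR.obj X (2 * p))), (∀ w ∈ W, Literature.AlgebraicGeometry.Motives.alongHomTensorEquiv ρ ((P.B.comap ρ).obj X (2 * p)) (P.iso ρ X (2 * p) ((1 : Literature.AlgebraicGeometry.Motives.AlongHom ℂ ρ) ⊗ₜ[k] w)) ∈ ((P.B.hodge hXρ (2 * p)).hodgeClasses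 p).baseChange ℂ) → (∀ (v : IsDedekindDomain.HeightOneSpectrum (NumberField.RingOfIntegers k)), Literature.AlgebraicGeometry.Motives.HasGoodReductionAt X n v → ∀ (Φ : Literature.AlgebraicGeometry.Motives.CrystallineFrobeniusDatum P.dR v (v.adicCompletion k)), ∀ w ∈ W, ∃ m : ℕ, 0 < m ∧ ((Φ.phi X (2 * p)) ^ m) ((1 : v.adicCompletion k) ⊗ₜ[k] w) = ((v.residueCard : v.adicCompletion k) ^ (p * m)) • ((1 : v.adicCompletion k) ⊗ₜ[k] w)) → ∀ β ∈ (P.B.hodge hXρ (2 * p)).hodgeClasses p, (1 : ℂ) ⊗ₜ[ℚ] β ∈ Submodule.span ℂ ((fun w => Literature.AlgebraicGeometry.Motives.alongHomTensorEquiv ρ ((P.B.comap ρ).obj X (2 * p)) (P.iso ρ X (2 * p) ((1 : Literature.AlgebraicGeometry.Motives.AlongHom ℂ ρ) ⊗ₜ[k] w))) '' (W : Set (P.dR.obj X (2 * p)))) → β ∈ P.B.W.algebraicClasses ((Literature.AlgebraicGeometry.Motives.baseChangeHom ρ).obj X) p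

-- earlier DeRhamPlanes (stmt-HodgeConjecture-13519, replaced 2026-08-15T19:37:09Z -> stmt-HodgeConjecture-13697): retired by None — ∀ ⦃k : Type⦄ [Field k] [NumberField k] (ρ : k →+* ℂ) (P : Literature.AlgebraicGeometry.Motives.PeriodRealization k), P.IsClassical → ∀ ⦃n : ℕ⦄ ⦃X : Literature.AlgebraicGeometry.Motives.SchemeOver k⦄, Literature.AlgebraicGeometry.Motives.IsSmoothProjective n X → ∀ (hXρ :
/-- item stmt-HodgeConjecture-13697 · crux · rank 4 · open · by planner
why it might fail: = de Rham part of 'Hodge ⇒ absolute Hodge' off abelian type (Ogus Hope 4.11.1; Voisin2007/KOU2023/Urbanik2022 need positive-dimensional Hodge loci): one irrational period-minor ratio at a rational attractor refutes it and HC; ∀-P typing admits exotic de Rham/Betti data.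
sources: Ogus1982, Deligne1982HodgeCycles, CharlesSchnell2014Notes, Voisin2007HodgeLoci, KlinglerOtwinowskaUrbanik2023, doi:10.1112/s0010437x2200745x
[crux] (card (P_dR) = (P_∞); de Rham part of Ogus Hope 4.11.1 / CharlesSchnell Conj 11.2.17 for
number-field varieties, in plane form) same setting (k number field, ρ, P a schema-pinned period
realization over k (HodgeRiemannIStatement P.B, HodgeRiemannIIStatement P.B, P.B.W.HasHardLefschetz
— the light stand-in for PeriodRealization.IsClassical since the 2026-08-15 cone repair), X/k smooth
projective of dim n, p); there is a k-subspace W ≤ H²ᵖ_dR(X/k) such that ι(W) ⊆ Hdgᵖ(X_ρ) ⊗ ℂ and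
every Hodge class β has β ⊗ 1 in the ℂ-span of ι(W), ι = P.iso ρ read in ℂ ⊗_ℚ H_B (so the ℂ-span of
ι(W) IS the Hodge plane). Under HC, W = Galois descent of the k̄-span of cycle classes. At a
rational rank-2 attractor of a CY3 pencil: the ratios of the 2×2 minors of the 2×3 attractor period
matrix (∫_{δ_i}∇^jΩ(s₀)) lie in k (numerically verified in print for AESZ34 and the BKSZ
hypergeometric attractors). [difficulty: open-problem] -/
@[route_item "route-HodgeConjecture-AdelicCoherence", crux]
def DeRhamPlanes : Prop :=
  ∀ ⦃k : Type⦄ [Field k] [NumberField k] (ρ : k →+* ℂ) (P : Literature.AlgebraicGeometry.Motives.PeriodRealization k), Literature.AlgebraicGeometry.Motives.HodgeRiemannIStatement P.B → Literature.AlgebraicGeometry.Motives.HodgeRiemannIIStatement P.B → P.B.W.HasHardLefschetz → ∀ ⦃n : ℕ⦄ ⦃X : Literature.AlgebraicGeometry.Motives.SchemeOver k⦄, Literature.AlgebraicGeometry.Motives.IsSmoothProjective n X → ∀ (hXρ : Literature.AlgebraicGeometry.Motives.IsSmoothProjective n ((Literature.AlgebraicGeometry.Motives.baseChangeHom ρ).obj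 X)) (p : ℕ), ∃ W : Submodule k (P.dR.obj X (2 * p)), (∀ w ∈ W, Literature.AlgebraicGeometry.Motives.alongHomTensorEquiv ρ ((P.B.comap ρ).obj X (2 * p)) (P.iso ρ X (2 * p) ((1 : Literature.AlgebraicGeometry.Motives.AlongHom ℂ ρ) ⊗ₜ[k] w)) ∈ ((P.B.hodge hXρ (2 * p)).hodgeClasses p).baseChange ℂ) ∧ ∀ β ∈ (P.B.hodge hXρ (2 * p)).hodgeClasses p, (1 : ℂ) ⊗ₜ[ℚ] β ∈ Submodule.span ℂ ((fun w => Literature.AlgebraicGeometry.Motives.alongHomTensorEquiv ρ ((P.B.comap ρ).obj X (2 * p)) (P.iso ρ X (2 * p) ((1 : Literature.AlgebraicGeometry.Motives.AlongHom ℂ ρ) ⊗ₜ[k] w))) '' (W : Set (P.dR.obj X (2 * p))))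

/-- item stmt-HodgeConjecture-1200 · crux · rank 5 · open · by planner
why it might fail: Proved only for weakly absolute classes (Voisin2007 = Charles–Schnell Thm 11.3.19: needs the Hodge-locus component through α defined over Q̄); false iff HC holds over Q̄ but a Hodge class at a transcendental isolated Hodge-locus point has no Q̄-envelope (zero period dim, open after KOU2023/BKU2024).
sources: Voisin2007HodgeLoci, CharlesSchnell2014Notes, KlinglerOtwinowskaUrbanik2023, BaldiKlinglerUllmo2024
[crux] ℚ̄-DESCENT on the real carriers: the Hodge conjecture (HodgeTheory.HodgeConjectureFor,
singular cohomology of complex points) for every smooth projective complex variety of the form X₀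
×_{ℚ̄,σ} ℂ implies the Hodge conjecture. Voisin2007HodgeLoci Prop. 1.2: HC for ℚ̄-varieties ⇒ HC for
(weakly) absolute Hodge classes; Thm 1.5 / Prop. 1.7: if a Hodge-locus component carries no constant
sub-VHS but ℚα it is defined over ℚ̄ and the class is covered. The general case is 'Hodge-locus
components through ℚ̄-generic points are defined over ℚ̄' (weak absoluteness) — OPEN;
KlinglerOtwinowskaUrbanik2023 give ℚ̄-definability for positive-period-dimension special
subvarieties of level ≥ 3, not for all components; the return from a ℚ̄-point of the locus to the
generic point is André's deformation theorem (Andre1996Motifs Thm 0.5, motivated-ness is horizontal)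
under B. Shared mechanism with cards motivated-anchor-transport / qbar-anchors-kou-andre-motivated
(other routes may want the same decl). In this route it is the only step leaving ℚ̄, where GPC says
nothing. Sources: Voisin2007HodgeLoci Prop. 1.2, Thm 1.5, Prop. 1.7; KlinglerOtwinowskaUrbanik2023;
CharlesSchnell2014Notes §11.2.5, Thm -/
@[route_item "route-HodgeConjecture-AdelicCoherence", crux]
def QbarDescent : Prop :=
  open Literature.AlgebraicGeometry.Motives Literature.AlgebraicGeometry.HodgeTheory in (∀ (σ : AlgebraicClosure ℚ →+* ℂ) ⦃n : ℕ⦄ ⦃X₀ : SchemeOver (AlgebraicClosure ℚ)⦄, IsSmoothProjective n ((baseChangeHom σ).obj X₀) → HodgeConjectureFor n ((baseChangeHom σ).obj X₀)) → _root_.HodgeConjecture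

/-- item stmt-HodgeConjecture-13520 · support · rank 9 · closed · proved by Summit.HodgeConjecture.HodgeConjecture.Theorems.adelicCoherence_numberFieldReduction_proof @ ff993d30d352 (prover) · by planner
sources: EGAIV3, VoisinHodgeI2002, Deligne2000
[support] KNOWN (EGA IV₃ 8.8.2/8.10.5/17.7.8 + isomorphism invariance of HodgeConjectureFor): HC for
all X₁ ×_ρ ℂ with X₁ smooth projective over a number field implies HC for all X₀ ×_σ ℂ with X₀ over
ℚ̄ — a finitely presented smooth projective geometrically irreducible ℚ̄-scheme descends to a number
field k ⊂ ℚ̄ with the same properties, X₀ ×_σ ℂ ≅ X₁ ×_{σ|k} ℂ, and HodgeConjectureFor is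
transported along isomorphisms of ℂ-schemes (homeomorphism of complex points, Hodge types and
supports of classes). [difficulty: L] -/
@[route_item "route-HodgeConjecture-AdelicCoherence", crux]
def NumberFieldReduction : Prop :=
  (∀ ⦃k : Type⦄ [Field k] [NumberField k] (ρ : k →+* ℂ) ⦃n : ℕ⦄ ⦃X : Literature.AlgebraicGeometry.Motives.SchemeOver k⦄, Literature.AlgebraicGeometry.Motives.IsSmoothProjective n X → Literature.AlgebraicGeometry.Motives.IsSmoothProjective n ((Literature.AlgebraicGeometry.Motives.baseChangeHom ρ).obj X) → Literature.AlgebraicGeometry.HodgeTheory.HodgeConjectureFor n ((Literature.AlgebraicGeometry.Motives.baseChangeHom ρ).obj X)) → ∀ (σ : AlgebraicClosure ℚ →+* ℂ) ⦃n : ℕ⦄ ⦃X₀ : Literature.AlgebraicGeometry.Motives.SchemeOver (AlgebraicClosure ℚ)⦄, Literature.AlgebraicGeometry.Motives.IsSmoothProjective n ((Literature.AlgebraicGeometry.Motives.baseChangeHom σ).obj X₀) → Literature.AlgebraicGeometry.HodgeTheory.HodgeConjectureFor n ((Literature.AlgebraicGeometry.Motives.baseChangeHom σ).obj X₀)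

-- earlier ClassicalPeriodData (stmt-HodgeConjecture-13521, replaced 2026-08-15T19:37:09Z -> stmt-HodgeConjecture-13698): retired by None — ∀ (k : Type) [Field k] [NumberField k], ∃ P : Literature.AlgebraicGeometry.Motives.PeriodRealization k, P.IsClassical ∧ ∀ v : IsDedekindDomain.HeightOneSpectrum (NumberField.RingOfIntegers k), Nonempty (Literature.AlgebraicGeometry.Motives.CrystallineFrobeniusDat
/-- item stmt-HodgeConjecture-13698 · support · rank 9 · open · by planner
sources: Grothendieck1966, BerthelotOgus1983, KatzMessing1974, VoisinHodgeI2002, Deligne2000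
[support] CONSTRUCTION + BRIDGE statement for the interface (existence is never a field of the
hypothesis structures; restated in the 2026-08-15 cone repair so that the route file no longer
imports Motives/PeriodRealizationClassical): for every number field k there is a period realization
P over k which (i) is schema-pinned — HodgeRiemannIStatement P.B, HodgeRiemannIIStatement P.B
(VoisinHodgeI2002 Thm 6.32), P.B.W.HasHardLefschetz; (ii) carries the real-carrier bridge — for
every smooth projective complex Y of dimension n with a Hodge model, (∀ p, P.B.HodgeConjectureFor hY
p) → HodgeTheory.HodgeConjectureFor n Y (for the classical datum: the tree theorem
BettiHodgeData.IsClassical.hodgeConjectureFor, Deligne2000 §1); (iii) carries a crystalline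
Frobenius datum with coefficients k_v at every finite place (Grothendieck 1966 + Berthelot–Ogus 1983
Thm 2.4/4.2 + Katz–Messing 1974; cf. exists_crystallineFrobeniusDatum,
IsSmoothProjective.baseChangeHom). `closes` uses (i)+(ii); (iii) records that the Tate hypothesis of
CoherentClassesAlgebraic is not vacuous. Proof route: ∃ P, P.IsClassical (the classical datum) +
Hodge–Riemann I/II and hard Lefschetz for X^an transported along IsClassic -/
@[route_item "route-HodgeConjecture-AdelicCoherence", crux]
def ClassicalPeriodData : Prop :=
  ∀ (k : Type) [Field k] [NumberField k], ∃ P : Literature.AlgebraicGeometry.Motives.PeriodRealization k, (Literature.AlgebraicGeometry.Motives.HodgeRiemannIStatement P.B ∧ Literature.AlgebraicGeometry.Motives.HodgeRiemannIIStatement P.B ∧ P.B.W.HasHardLefschetz) ∧ (∀ ⦃n : ℕ⦄ ⦃Y : Literature.AlgebraicGeometry.Motives.SchemeOver ℂ⦄ (hY : Literature.AlgebraicGeometry.Motives.IsSmoothProjective n Y), Nonempty (Literature.AlgebraicGeometry.HodgeTheory.HodgeModel n Y) → (∀ p : ℕ, P.B.HodgeConjectureFor hY p) → Literature.AlgebraicGeometry.HodgeTheory.HodgeConjectureFor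 n Y) ∧ ∀ v : IsDedekindDomain.HeightOneSpectrum (NumberField.RingOfIntegers k), Nonempty (Literature.AlgebraicGeometry.Motives.CrystallineFrobeniusDatum P.dR v (v.adicCompletion k))

-- earlier AttractorPlanesCoherent (stmt-HodgeConjecture-13522, replaced 2026-08-15T19:37:09Z -> stmt-HodgeConjecture-13699): retired by None — ∀ ⦃k : Type⦄ [Field k] [NumberField k] (ρ : k →+* ℂ) (P : Literature.AlgebraicGeometry.Motives.PeriodRealization k), P.IsClassical → ∀ ⦃n : ℕ⦄ ⦃X : Literature.AlgebraicGeometry.Motives.SchemeOver k⦄, Literature.AlgebraicGeometry.Motives.IsSmoothProjective n X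
/-- item stmt-HodgeConjecture-13699 · support · rank 9 · open · by planner
sources: CandelasEtAl2020, BonischEtAl2024, arXiv:2104.07816, Ogus1982, CharlesSchnell2014Notes
[support] THE CARD'S NAME-SAKE SPECIAL CASE (rank-2 attractor planes; test-bed of cruxes 2 and 4): k
number field, ρ, P a schema-pinned period realization over k (HodgeRiemannIStatement P.B,
HodgeRiemannIIStatement P.B, P.B.W.HasHardLefschetz — the light stand-in for
PeriodRealization.IsClassical since the 2026-08-15 cone repair), X/k smooth projective of dim n, T ≤
Hⁿ_B(X_ρ, ℚ) a rational plane of rank 2 containing Fⁿ = H^{n,0} with h^{n,0} = 1 (T_ℂ = H^{n,0} ⊕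
H^{0,n}, the unique such sub-Hodge structure: CY3 pencils at rational rank-2 attractors,
CandelasEtAl2020 AESZ34 at s₀ = −1/7, BonischEtAl2024 §3.3; singular K3 for n = 2). CLAIM: T_ℂ =
iso_ρ(W ⊗ ℂ) for a k-plane W ≤ Hⁿ_dR(X/k) (spelled like the axiom iso_fil), AND at every good place
v, for every Frobenius datum Φ, W ⊗ k_v is φ_v^m-stable for some m ≥ 1. HC(X_ρ × X_ρ) implies it
with m = 1 (π_T is the class of a k-rational ℚ-cycle by uniqueness of T + Galois averaging;
Gillet–Messing). Decidable instance: PSLQ on period minors (done in print) + U_p(s₀)-stability of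
the BKSZ rational plane mod p^N for p = 5…31. Sources: CandelasEtAl2020, BonischEtAl2024,
arXiv:2104.07816, Ogus1982, CharlesSchnell2014Notes. [difficulty: open -/
@[route_item "route-HodgeConjecture-AdelicCoherence"]
def AttractorPlanesCoherent : Prop :=
  ∀ ⦃k : Type⦄ [Field k] [NumberField k] (ρ : k →+* ℂ) (P : Literature.AlgebraicGeometry.Motives.PeriodRealization k), Literature.AlgebraicGeometry.Motives.HodgeRiemannIStatement P.B → Literature.AlgebraicGeometry.Motives.HodgeRiemannIIStatement P.B → P.B.W.HasHardLefschetz → ∀ ⦃n : ℕ⦄ ⦃X : Literature.AlgebraicGeometry.Motives.SchemeOver k⦄, Literature.AlgebraicGeometry.Motives.IsSmoothProjective n X → ∀ (hXρ : Literature.AlgebraicGeometry.Motives.IsSmoothProjective n ((Literature.AlgebraicGeometry.Motives.baseChangeHom ρ).obj X)) (T : Submodule ℚ ((P.B.comap ρ).obj X n)), Module.finrank ℚ T = 2 → (P.B.hodge hXρ n).F n ≤ T.baseChange ℂ → Module.finrank ℂ ((P.B.hodge hXρ n).F n) = 1 → ∃ W : Submodule k (P.dR.obj X n), (((W.baseChange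 (Literature.AlgebraicGeometry.Motives.AlongHom ℂ ρ)).map (P.iso ρ X n)).restrictScalars ℚ).map (Literature.AlgebraicGeometry.Motives.alongHomTensorEquiv ρ ((P.B.comap ρ).obj X n)).toLinearMap = (T.baseChange ℂ).restrictScalars ℚ ∧ ∀ (v : IsDedekindDomain.HeightOneSpectrum (NumberField.RingOfIntegers k)), Literature.AlgebraicGeometry.Motives.HasGoodReductionAt X n v → ∀ (Φ : Literature.AlgebraicGeometry.Motives.CrystallineFrobeniusDatum P.dR v (v.adicCompletion k)), ∃ m : ℕ, 0 < m ∧ ∀ w ∈ W, ((Φ.phi X n) ^ m) ((1 : v.adicCompletion k) ⊗ₜ[k] w) ∈ W.baseChange (v.adicCompletion k)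

-- earlier CoherenceGlue (stmt-HodgeConjecture-14206, replaced 2026-08-16T03:25:44Z -> stmt-HodgeConjecture-14448): retired by None — FrobeniusPlanes → CoherentClassesAlgebraic → DeRhamPlanes → ClassicalPeriodData → HodgeModelsExist → HodgeConjectureNumberFields
/-- item stmt-HodgeConjecture-14448 · support · rank 9 · closed · proved by Summit.HodgeConjecture.HodgeConjecture.Theorems.adelicCoherence_coherenceGlue_proof @ 6184aa665188 (prover) · by planner
sources: Ogus1982, Deligne2000, VoisinHodgeI2002
[support] GLUE (route-internal logic, pure composition; badge repair 2026-08-16): the three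
coherence cruxes FrobeniusPlanes (F), CoherentClassesAlgebraic (C), DeRhamPlanes (D), fed the
schema-pinned period realization with its real-carrier bridge (ClassicalPeriodData, clauses
(i)+(ii)) and the existence of Hodge models (the hypothesis is the body of the shared item
HodgeModelsExist VERBATIM — inlined because the gate renders shared items after the route's own
supports; `hM : HodgeModelsExist` fills the slot by definitional unfolding, `rfl` in Sketch.lean),
decide the target HodgeConjectureNumberFields: for X/k smooth projective and ρ : k →+* ℂ take P from
ClassicalPeriodData; its bridge reduces HodgeTheory.HodgeConjectureFor n X_ρ to ∀ p,
P.B.HodgeConjectureFor hXρ p, i.e. (BettiHodgeData.hodgeConjectureFor_iff) every Hodge class β lies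
in ℚ·Aᵖ; D gives the k-plane W, F makes every w ∈ W potentially Tate at every good place for every
Frobenius datum Φ, and C returns β ∈ P.B.W.algebraicClasses X_ρ p. Exactly the inner part of
`closes` (which continues with NumberFieldReduction and QbarDescent to the Statement). PROVED
sorry-free in the planner's Sketch.lean (`coherenceGlue_holds`, -/
@[route_item "route-HodgeConjecture-AdelicCoherence"]
def CoherenceGlue : Prop :=
  FrobeniusPlanes → CoherentClassesAlgebraic → DeRhamPlanes → ClassicalPeriodData → (∀ (n : ℕ) (X : Literature.AlgebraicGeometry.Motives.SchemeOver ℂ), Literature.AlgebraicGeometry.Motives.IsSmoothProjective n X → Nonempty (Literature.AlgebraicGeometry.HodgeTheory.HodgeModel n X)) → HodgeConjectureNumberFields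

/-- item stmt-HodgeConjecture-2742 · support · rank 9 · closed · proved by Summit.HodgeConjecture.HodgeConjecture.Theorems.holomorphicDefect_hodgeModelsExist_proof @ 852a466105f7 (prover) · by planner
sources: SerreGAGA1956, VoisinHodgeI2002, Deligne2000
[support] = ∀ n X, Literature.AlgebraicGeometry.HodgeTheory.nonempty_hodgeModel n X (Serre GAGA §2 +
de Rham + the Hodge decomposition of the compact Kähler X^an); tree named fact, discharge in
progress (HodgeModelExistenceDischarge). [difficulty: L] -/
@[route_item "route-HodgeConjecture-AdelicCoherence", crux]
def HodgeModelsExist : Prop :=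
  ∀ (n : ℕ) (X : Literature.AlgebraicGeometry.Motives.SchemeOver ℂ), Literature.AlgebraicGeometry.Motives.IsSmoothProjective n X → Nonempty (Literature.AlgebraicGeometry.HodgeTheory.HodgeModel n X)

/-- `HodgeModelsExist` holds: proved by `Summit.HodgeConjecture.HodgeConjecture.Theorems.holomorphicDefect_hodgeModelsExist_proof` @ 852a466105f7. -/
theorem HodgeModelsExist_holds : HodgeModelsExist := _root_.Summit.HodgeConjecture.HodgeConjecture.Theorems.holomorphicDefect_hodgeModelsExist_proof

/-- item stmt-HodgeConjecture-13523 · assembly · rank 1 · closed · proved by Summit.HodgeConjecture.HodgeConjecture.Theorems.adelicCoherence_assembly_proof @ 56db29b4b4db (prover) · by planner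
sources: Ogus1982, Voisin2007HodgeLoci, Deligne2000
[assembly] FrobeniusPlanes → CoherentClassesAlgebraic → DeRhamPlanes → QbarDescent →
NumberFieldReduction → ClassicalPeriodData → HodgeModelsExist → HodgeConjecture (the type of
`closes`). -/
@[route_item "route-HodgeConjecture-AdelicCoherence"]
def Assembly : Prop :=
  FrobeniusPlanes → CoherentClassesAlgebraic → DeRhamPlanes → QbarDescent → NumberFieldReduction → ClassicalPeriodData → HodgeModelsExist → _root_.HodgeConjecture

/-! D-0027 §2.1 — DECIDING THEOREM (planner-authored via `route open/edit --closes-file`; by planner-rrepair-HodgeConjecture-AdelicCoherenc-787200ee-0 2026-08-15T19:37:09Z):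
its hypotheses are this route's items and its conclusion the sub-problem Statement (glue_lint), and it elaborates with this file. -/

@[closes "route-HodgeConjecture-AdelicCoherence"] theorem closes (hF : FrobeniusPlanes) (hC : CoherentClassesAlgebraic) (hD : DeRhamPlanes)
    (hQ : QbarDescent) (hR : NumberFieldReduction) (hP : ClassicalPeriodData)
    (hM : HodgeModelsExist) : _root_.HodgeConjecture := by
  refine hQ (hR ?_)
  intro k _ _ ρ n X hX hXρ
  obtain ⟨P, ⟨hI, hII, hL⟩, hbr, -⟩ := hP k
  refine hbr hXρ (hM n _ hXρ) (fun p => ?_)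
  refine (P.B.hodgeConjectureFor_iff hXρ p).2 ?_
  intro β hβ
  obtain ⟨W, hW₁, hW₂⟩ := hD ρ P hI hII hL hX hXρ p
  exact hC ρ P hI hII hL hX hXρ p W hW₁
    (fun v hv Φ w hw => hF ρ P hI hII hL hX hXρ p v hv Φ w (hW₁ w hw)) β hβ (hW₂ β hβ)

end Summit.HodgeConjecture.HodgeConjecture.Theses.AdelicCoherence
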